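import Summits.NavierStokesRegularity.NavierStokesRegularity.Theorems.TypeIQuarterGateQuarterLawEventual
import Summits.NavierStokesRegularity.NavierStokesRegularity.Theorems.TypeICertificateLadderRungReynoldsOneAprioriDecay
import Summits.NavierStokesRegularity.NavierStokesRegularity.Theorems.StretchingWellBindingEnstrophyQuarterLawToEnergyHalfHolder
import Literature.Analysis.FluidPDE.BKMClassGradientContinuity
import Literature.Analysis.FluidPDE.EnstrophyGronwall
import Literature.Analysis.FluidPDE.TaoClassGlue
import HarnessLib

/-!
# `TypeIQuarterGate`: on Type-I blow-ups the quarter law IS the energy ½-Hölder law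
# (crux `QuarterLawTypeI` 23726 ⟺ crux `EnergyHalfHolder` 25161 restricted to Type I)

`--supports stmt-NavierStokesRegularity-23726` (helper; cross-route edge to route `HalfHolderEnergy`).

K1 = `QuarterLawTypeI` asks for the SLICE law `Z(t) := ∫‖curl u(t)‖² ≤ K/√(T−t)` on `[0,T)` along a
maximal classical Leray–Hopf solution from a rapidly decaying datum with the sup-norm Type-I rate at
`T`.  Integrating in time gives the WINDOW law `∫_a^b Z ≤ 2K√(b−a)` (tree:
`WindowConverters.lintegral_Ioo_le_sqrt_of_slice_le`), which — since
`2ν∫_a^b ‖∇u‖² = ‖u(a)‖₂² − ‖u(b)‖₂²` in Tao's class — is the ½-HÖLDER CONTINUITY OF THE KINETIC ENERGY,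
the conclusion of the crux `EnergyHalfHolder` (stmt-25161, route `HalfHolderEnergy`, stated for ALL
maximal solutions).  This file proves the CONVERSE on the Type-I class:

* `lintegral_frobeniusNormSq_le_exp_mul_of_bound` — two-time Serrin–Grönwall step in the frame: if
  `|u| ≤ M` on `[s,t] × ℝ³` (`0 ≤ s < t < T`) then `∫⁻|∇u(t)|²_F ≤ e^{M²(t−s)/(2ν)} ∫⁻|∇u(s)|²_F`
  (Tao representation on `[0,(t+T)/2]`, restarted at `s` by `IsTaoSolutionOn.translate`, and the
  tree's `lintegral_frobeniusNormSq_fderiv_le_mul_exp`).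
* `quarterLaw_of_terminalWindowLaw_of_rate` — **TERMINAL WINDOW LAW ⟹ SLICE LAW under the rate**:
  if `√(T−t)‖u(t,x)‖ ≤ C√ν` eventually and `∫_a^T Z ≤ K_w √(T−a)` for all `a ∈ [0,T)`, then
  `Z(t) ≤ K/√(T−t)` on `[0,T)` with `K = e^{C'²/2}(√2·K_w + 1)`, `C' = max C 1`.  Mechanism: on the
  backward window `[2t−T, t]` of length `δ = T−t` the window law pays `≤ K_w√(2δ)`, so some slice
  `s` there has `Z(s) ≤ (√2 K_w + 1)/√δ`; on `[s,t]` the rate bounds `|u| ≤ C'√ν/√δ`, so the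
  Grönwall factor from `s` to `t` is at most `e^{C'²/2}` — uniformly in `δ`.  This is where the Type-I
  rate is used: it makes the parabolic window `[t−δ,t]` exactly one Grönwall unit long.
* BY NAME: `energyHalfHolderTypeI_of_quarterLawTypeI`, `quarterLawTypeI_of_energyHalfHolderTypeI`,
  `quarterLawTypeI_iff_energyHalfHolderTypeI` — **`QuarterLawTypeI` ⟺ `EnergyHalfHolder` restricted to
  the Type-I blow-ups of K1's class** (window conclusion verbatim that of 25161); and the inter-route
  edge `quarterLawTypeI_of_energyHalfHolder : EnergyHalfHolder → QuarterLawTypeI` (25161 ⟹ 23726,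
  unconditional).  With the census identity `EQL 1574 ⟹ EHH 25161` (tree
  `WindowConverters.energyHalfHolder_of_enstrophyQuarterLaw`) and `K1 ∧ NoTypeII ⟹ EQL`, the three
  cruxes 1574 / 25161 / 23726 coincide modulo `NoTypeII` (0056).

Repair-census wording for 23726: the missing estimate may be stated in ENERGY currency — along a
sup-norm Type-I blow-up, `‖u(t)‖₂² − lim_{s↑T}‖u(s)‖₂² ≤ K√(T−t)` (energy drop of order `√(T−t)` into
the singular time); the slice law, the weak-`L³` bound (24108) and the ε-concentration count (23970)
are equivalent forms (p818591, p816056).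

HONEST FRAMING: compositions of tree theorems along a HYPOTHETICAL blow-up; `QuarterLawTypeI` and
`EnergyHalfHolder` remain OPEN; nothing about Navier–Stokes regularity is claimed. [folklore]
-/

-- the problem directory repeats the summit name (`NavierStokesRegularity/NavierStokesRegularity`)
set_option linter.dupNamespace false

noncomputable section

open Set Filter Topology MeasureTheory
open scoped ENNReal NNReal ContDiff

namespace Summit.NavierStokesRegularity.NavierStokesRegularity.Theorems

namespace QuarterLawWindow

open Literature.Analysis.FluidPDE
open Summit.NavierStokesRegularity.NavierStokesRegularity.Theorems.RungReynoldsOne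
  (stub_taoCover enorm_curl_sq_le_six_mul exists_isTaoSolutionOn_of_hasBoundedSobolevNormsOn)

/-! ### Frame tools -/

/-- A Tao-class representation on every closed sub-slab `[0,T']`, `T' < T`, of a classical
Leray–Hopf rapidly-decaying-datum solution on `[0,T)` (Tao 2013 Thm 5.4 / Cor 11.1, tree
`tao2011_hasBoundedSobolevNormsOn_holds` + `exists_isTaoSolutionOn_of_hasBoundedSobolevNormsOn`).
[folklore] -/
theorem exists_isTaoSolutionOn_of_frame {ν T : ℝ} (hν : 0 < ν)
    {u : ℝ → EuclideanSpace ℝ (Fin 3) → EuclideanSpace ℝ (Fin 3)}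
    {p : ℝ → EuclideanSpace ℝ (Fin 3) → ℝ}
    (hsol : IsClassicalNSSolutionOn (Ico 0 T) ν 0 u p) (hLH : IsLerayHopfOn T ν 0 (u 0) u)
    (hdec : HasRapidSpatialDecay (u 0)) {T' : ℝ} (hT' : T' ∈ Ioo 0 T) :
    ∃ q : ℝ → EuclideanSpace ℝ (Fin 3) → ℝ, IsTaoSolutionOn T' ν (u 0) u q := by
  have hsolc : IsClassicalNSSolutionOn (Icc 0 T') ν 0 u p :=
    hsol.mono (Icc_subset_Ico_right hT'.2) (uniqueDiffOn_Icc hT'.1)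
  have hE : ∃ C : ℝ≥0, ∀ t ∈ Icc 0 T', ∫⁻ x, ‖u t x‖ₑ ^ 2 ≤ C :=
    ⟨(2 * VectorCalculus.kineticEnergy (u 0)).toNNReal, fun t ht =>
      hLH.lintegral_enorm_sq_le hν.le ⟨ht.1, ht.2.trans hT'.2.le⟩⟩
  have hB : HasBoundedSobolevNormsOn (Icc 0 T') u :=
    tao2011_hasBoundedSobolevNormsOn_holds hν hT'.1 hsolc hE hdec
  exact exists_isTaoSolutionOn_of_hasBoundedSobolevNormsOn hν hT'.1 hsolc hB

/-- In the frame, `∫⁻ |∇u(τ)|²_F = ∫⁻ ‖curl u(τ)‖ₑ²` slice by slice, `τ ∈ [0,T)` (Tao's class on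
`[0,(τ+T)/2]` supplies `u(τ), Du(τ), D²u(τ) ∈ L²`; tree
`lintegral_frobeniusNormSq_fderiv_eq_lintegral_curl_sq`). [folklore] -/
theorem lintegral_frobeniusNormSq_eq_lintegral_curl_sq {ν T : ℝ} (hν : 0 < ν) (hT : 0 < T)
    {u : ℝ → EuclideanSpace ℝ (Fin 3) → EuclideanSpace ℝ (Fin 3)}
    {p : ℝ → EuclideanSpace ℝ (Fin 3) → ℝ}
    (hsol : IsClassicalNSSolutionOn (Ico 0 T) ν 0 u p) (hLH : IsLerayHopfOn T ν 0 (u 0) u)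
    (hdec : HasRapidSpatialDecay (u 0)) {τ : ℝ} (hτ : τ ∈ Ico 0 T) :
    ∫⁻ x, ENNReal.ofReal (frobeniusNormSq (fderiv ℝ (u τ) x)) = ∫⁻ x, ‖curl (u τ) x‖ₑ ^ 2 := by
  have hτ' : (τ + T) / 2 ∈ Ioo 0 T := ⟨by linarith [hτ.1], by linarith [hτ.2]⟩
  obtain ⟨q, -, hut, -, -⟩ := stub_taoCover hν hT hsol hLH hdec hτ'
  have hτI : τ ∈ Icc 0 ((τ + T) / 2) := ⟨hτ.1, by linarith [hτ.2]⟩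
  have hn : ∀ n : ℕ, ∫⁻ x, ‖iteratedFDeriv ℝ n (u τ) x‖ₑ ^ 2 < ⊤ := fun n => by
    obtain ⟨Cn, hCn⟩ := hut n
    exact (hCn τ hτI).trans_lt ENNReal.coe_lt_top
  have h0 : ∫⁻ x, ‖u τ x‖ₑ ^ 2 < ⊤ := by
    refine lt_of_le_of_lt (le_of_eq (lintegral_congr fun x => ?_)) (hn 0)
    rw [← ofReal_norm, ← norm_iteratedFDeriv_zero (𝕜 := ℝ) (f := u τ), ofReal_norm]
  have hsm : ContDiff ℝ 2 (u τ) := (hsol.contDiff_velocity hτ).of_le (by norm_cast)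
  exact lintegral_frobeniusNormSq_fderiv_eq_lintegral_curl_sq hsm (hsol.divFree τ hτ) h0 (hn 1) (hn 2)

/-- **Two-time Serrin–Grönwall step in the frame.** Along a classical Leray–Hopf
rapidly-decaying-datum solution on `[0,T)`: if `|u| ≤ M` on `[s,t] × ℝ³` with `0 ≤ s < t < T`,
`M > 0`, then `∫⁻|∇u(t)|²_F ≤ exp(M²(t−s)/(2ν)) · ∫⁻|∇u(s)|²_F` (the Tao representation on
`[0,(t+T)/2]` restarted at `s`, `IsTaoSolutionOn.translate`/`.mono`, and Lemarié-Rieusset's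
endpoint-Serrin enstrophy inequality `lintegral_frobeniusNormSq_fderiv_le_mul_exp`).
[cite: LemarieRieusset2016, Thm. 11.2 (11.11)] -/
theorem lintegral_frobeniusNormSq_le_exp_mul_of_bound {ν T : ℝ} (hν : 0 < ν)
    {u : ℝ → EuclideanSpace ℝ (Fin 3) → EuclideanSpace ℝ (Fin 3)}
    {p : ℝ → EuclideanSpace ℝ (Fin 3) → ℝ}
    (hsol : IsClassicalNSSolutionOn (Ico 0 T) ν 0 u p) (hLH : IsLerayHopfOn T ν 0 (u 0) u)
    (hdec : HasRapidSpatialDecay (u 0)) {s t M : ℝ} (hs : 0 ≤ s) (hst : s < t) (htT : t < T)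
    (hM : 0 < M) (hbd : ∀ σ ∈ Icc s t, ∀ x, ‖u σ x‖ ≤ M) :
    ∫⁻ x, ENNReal.ofReal (frobeniusNormSq (fderiv ℝ (u t) x)) ≤
      ENNReal.ofReal (Real.exp (M ^ 2 * (t - s) / (2 * ν))) *
        ∫⁻ x, ENNReal.ofReal (frobeniusNormSq (fderiv ℝ (u s) x)) := by
  have ht' : (t + T) / 2 ∈ Ioo 0 T := ⟨by linarith, by linarith⟩
  obtain ⟨P, hP⟩ := exists_isTaoSolutionOn_of_frame hν hsol hLH hdec ht'
  have hts : 0 < t - s := sub_pos.2 hst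
  have h2 : IsTaoSolutionOn (t - s) ν (u s) (fun r => u (r + s)) (fun r => P (r + s)) :=
    (hP.translate hs (by linarith)).mono hts (by linarith)
  have hbd' : ∀ r ∈ Icc 0 (t - s), ∀ x, ‖u (r + s) x‖ ≤ M := fun r hr x =>
    hbd (r + s) ⟨by linarith [hr.1], by linarith [hr.2]⟩ x
  have hmem : t - s ∈ Ioc 0 (t - s) := ⟨hts, le_rfl⟩
  have hgr := lintegral_frobeniusNormSq_fderiv_le_mul_exp hν hts h2.classical h2.sobolev
    h2.sobolev_dt h2.sobolev_p hM hmem hbd'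
  simp only [sub_add_cancel, zero_add] at hgr
  exact hgr

/-! ### Terminal window law ⟹ slice law, under the rate -/

/-- **Under the Type-I rate, the energy ½-Hölder law at `T` gives Leray's upper quarter rate.**
Classical Leray–Hopf rapidly-decaying-datum solution on `[0,T)` (`ν, T > 0`) with eventual rate
`√(T−t)‖u(t,x)‖ ≤ C√ν`; if `∫_a^T ∫‖curl u‖² ≤ K_w √(T−a)` for every `a ∈ [0,T)` (terminal
windows), then `∫‖curl u(t)‖² ≤ K/√(T−t)` on `[0,T)`. [folklore] -/
theorem quarterLaw_of_terminalWindowLaw_of_rate {ν T C : ℝ} (hν : 0 < ν) (hT : 0 < T)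
    {u : ℝ → EuclideanSpace ℝ (Fin 3) → EuclideanSpace ℝ (Fin 3)}
    {p : ℝ → EuclideanSpace ℝ (Fin 3) → ℝ}
    (hsol : IsClassicalNSSolutionOn (Ico 0 T) ν 0 u p) (hLH : IsLerayHopfOn T ν 0 (u 0) u)
    (hdec : HasRapidSpatialDecay (u 0))
    (hrate : ∀ᶠ t in 𝓝[<] T, ∀ x, Real.sqrt (T - t) * ‖u t x‖ ≤ C * Real.sqrt ν)
    (hwin : ∃ K_w : ℝ, ∀ a ∈ Ico 0 T,
      ∫⁻ s in Ioo a T, ∫⁻ x, ‖curl (u s) x‖ₑ ^ 2 ≤ ENNReal.ofReal (K_w * Real.sqrt (T - a))) :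
    ∃ K : ℝ, ∀ t ∈ Ico 0 T,
      ∫⁻ x, ‖curl (u t) x‖ₑ ^ 2 ≤ ENNReal.ofReal (K / Real.sqrt (T - t)) := by
  obtain ⟨K_w, hKw⟩ := hwin
  -- the onset of the rate, and a positive rate constant `C' = max C 1`
  obtain ⟨a₀, ha₀T, hsub⟩ := mem_nhdsLT_iff_exists_Ioo_subset.1 hrate
  set C' : ℝ := max C 1 with hC'
  have hC'0 : 0 < C' := lt_of_lt_of_le one_pos (le_max_right _ _)
  have hrate' : ∀ σ ∈ Ioo a₀ T, ∀ x, Real.sqrt (T - σ) * ‖u σ x‖ ≤ C' * Real.sqrt ν :=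
    fun σ hσ x => (hsub hσ x).trans
      (mul_le_mul_of_nonneg_right (le_max_left _ _) (Real.sqrt_nonneg _))
  -- nonnegative window constant
  set Kw : ℝ := max K_w 0 with hKw_def
  have hKw0 : 0 ≤ Kw := le_max_right _ _
  have hKw' : ∀ a ∈ Ico 0 T,
      ∫⁻ s in Ioo a T, ∫⁻ x, ‖curl (u s) x‖ₑ ^ 2 ≤ ENNReal.ofReal (Kw * Real.sqrt (T - a)) :=
    fun a ha => (hKw a ha).trans (ENNReal.ofReal_le_ofReal
      (mul_le_mul_of_nonneg_right (le_max_left _ _) (Real.sqrt_nonneg _)))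
  -- the final window `[t₁, T)`, `t₁ = (T + max a₀ 0)/2`
  set t₁ : ℝ := (T + max a₀ 0) / 2 with ht₁
  have hm : max a₀ 0 < T := max_lt ha₀T hT
  have ht₁T : t₁ < T := by rw [ht₁]; linarith
  set K : ℝ := Real.exp (C' ^ 2 / 2) * (Real.sqrt 2 * Kw + 1) with hK_def
  have key : ∀ t ∈ Ico t₁ T,
      ∫⁻ x, ‖curl (u t) x‖ₑ ^ 2 ≤ ENNReal.ofReal (K / Real.sqrt (T - t)) := by
    intro t ht
    -- the backward window `[a, t]`, `a = 2t − T`, of length `δ = T − t`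
    set δ : ℝ := T - t with hδ
    have hδ0 : 0 < δ := by rw [hδ]; linarith [ht.2]
    have hsδ : 0 < Real.sqrt δ := Real.sqrt_pos.2 hδ0
    set a : ℝ := t - δ with ha_def
    have hma : max a₀ 0 ≤ a := by
      have h1 := ht.1; rw [ht₁] at h1; rw [ha_def, hδ]; linarith
    have ha0 : 0 ≤ a := (le_max_right a₀ 0).trans hma
    have haa₀ : a₀ ≤ a := (le_max_left a₀ 0).trans hma
    have hat : a < t := by rw [ha_def]; linarith
    have haT : a ∈ Ico 0 T := ⟨ha0, hat.trans ht.2⟩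
    have hTa : T - a = 2 * δ := by rw [ha_def, hδ]; ring
    -- the window law on `(a, t) ⊆ (a, T)`
    have hwin_t : ∫⁻ s in Ioo a t, ∫⁻ x, ‖curl (u s) x‖ₑ ^ 2 ≤
        ENNReal.ofReal (Kw * Real.sqrt (2 * δ)) := by
      refine (lintegral_mono_set (Ioo_subset_Ioo_right ht.2.le)).trans ?_
      have h := hKw' a haT
      rwa [hTa] at h
    -- a good slice `s ∈ (a, t)` with `Z(s) ≤ (√2 Kw + 1)/√δ`
    set B : ℝ := (Real.sqrt 2 * Kw + 1) / Real.sqrt δ with hB_def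
    have hB0 : 0 < B := by positivity
    have hgood : ∃ s ∈ Ioo a t, ∫⁻ x, ‖curl (u s) x‖ₑ ^ 2 ≤ ENNReal.ofReal B := by
      by_contra hne
      push Not at hne
      have hlow : ENNReal.ofReal B * volume (Ioo a t) ≤
          ∫⁻ s in Ioo a t, ∫⁻ x, ‖curl (u s) x‖ₑ ^ 2 := by
        rw [← setLIntegral_const]
        exact setLIntegral_mono' measurableSet_Ioo fun s hs => (hne s hs).le
      rw [Real.volume_Ioo, show t - a = δ by rw [ha_def]; ring, ← ENNReal.ofReal_mul hB0.le]
        at hlow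
      have hBδ : B * δ = (Real.sqrt 2 * Kw + 1) * Real.sqrt δ := by
        rw [hB_def, div_mul_eq_mul_div, mul_div_assoc, Real.div_sqrt]
      have h2δ : Real.sqrt (2 * δ) = Real.sqrt 2 * Real.sqrt δ := Real.sqrt_mul (by norm_num) δ
      have hlt : ENNReal.ofReal (Kw * Real.sqrt (2 * δ)) < ENNReal.ofReal (B * δ) := by
        rw [ENNReal.ofReal_lt_ofReal_iff (mul_pos hB0 hδ0), hBδ, h2δ]
        nlinarith [hsδ, hKw0]
      exact absurd ((hlow.trans hwin_t).trans_lt hlt) (lt_irrefl _)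
    obtain ⟨s, hs, hZs⟩ := hgood
    have hs0 : 0 ≤ s := ha0.trans hs.1.le
    have hsT : s ∈ Ico 0 T := ⟨hs0, hs.2.trans ht.2⟩
    have htT : t ∈ Ico 0 T := ⟨hs0.trans hs.2.le, ht.2⟩
    -- the sup bound `|u| ≤ C'√ν/√δ` on `[s, t] × ℝ³`
    set M : ℝ := C' * Real.sqrt ν / Real.sqrt δ with hM_def
    have hM0 : 0 < M := by positivity
    have hbd : ∀ σ ∈ Icc s t, ∀ x, ‖u σ x‖ ≤ M := by
      intro σ hσ x
      have hσT : σ < T := hσ.2.trans_lt ht.2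
      have hσa₀ : a₀ < σ := haa₀.trans_lt (hs.1.trans_le hσ.1)
      have hsσ : 0 < Real.sqrt (T - σ) := Real.sqrt_pos.2 (sub_pos.2 hσT)
      have h1 := hrate' σ ⟨hσa₀, hσT⟩ x
      have h2 : ‖u σ x‖ ≤ C' * Real.sqrt ν / Real.sqrt (T - σ) := by
        rw [le_div_iff₀ hsσ, mul_comm]; exact h1
      refine h2.trans ?_
      rw [hM_def]
      exact div_le_div_of_nonneg_left (by positivity) hsδ
        (Real.sqrt_le_sqrt (by rw [hδ]; linarith [hσ.2]))
    -- Grönwall from `s` to `t`: factor `≤ e^{C'²/2}`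
    have hgr := lintegral_frobeniusNormSq_le_exp_mul_of_bound hν hsol hLH hdec hs0 hs.2 ht.2 hM0 hbd
    rw [lintegral_frobeniusNormSq_eq_lintegral_curl_sq hν hT hsol hLH hdec htT,
      lintegral_frobeniusNormSq_eq_lintegral_curl_sq hν hT hsol hLH hdec hsT] at hgr
    have hexp : Real.exp (M ^ 2 * (t - s) / (2 * ν)) ≤ Real.exp (C' ^ 2 / 2) := by
      refine Real.exp_le_exp.2 ?_
      have hts : t - s ≤ δ := by rw [hδ]; linarith [hs.1, hat, ha_def]
      have hM2 : M ^ 2 = C' ^ 2 * ν / δ := by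
        rw [hM_def, div_pow, mul_pow, Real.sq_sqrt hν.le, Real.sq_sqrt hδ0.le]
      rw [hM2, div_le_div_iff₀ (by positivity) (by norm_num)]
      have h1 : C' ^ 2 * ν / δ * (t - s) ≤ C' ^ 2 * ν / δ * δ :=
        mul_le_mul_of_nonneg_left hts (by positivity)
      rw [div_mul_cancel₀ _ hδ0.ne'] at h1
      nlinarith [h1, hν]
    calc ∫⁻ x, ‖curl (u t) x‖ₑ ^ 2
        ≤ ENNReal.ofReal (Real.exp (M ^ 2 * (t - s) / (2 * ν))) * ∫⁻ x, ‖curl (u s) x‖ₑ ^ 2 := hgr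
      _ ≤ ENNReal.ofReal (Real.exp (C' ^ 2 / 2)) * ENNReal.ofReal B :=
          mul_le_mul' (ENNReal.ofReal_le_ofReal hexp) hZs
      _ = ENNReal.ofReal (K / Real.sqrt (T - t)) := by
          rw [← ENNReal.ofReal_mul (Real.exp_pos _).le, hK_def, hB_def, hδ]
          congr 1; ring
  exact LorentzOfEnvelope.quarterLaw_of_eventually hν hT hsol hLH hdec ⟨K, t₁, ht₁T, key⟩

/-! ### By name: `QuarterLawTypeI` ⟺ `EnergyHalfHolder` on the Type-I class -/

open Summit.NavierStokesRegularity.NavierStokesRegularity.Theses.TypeIQuarterGate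
open Summit.NavierStokesRegularity.NavierStokesRegularity.Theses.HalfHolderEnergy (EnergyHalfHolder)

/-- `IsTypeIBlowup` in the rate currency: some `C` with `√(T−t)‖u(t,x)‖ ≤ C√ν` eventually.
[folklore] -/
theorem exists_rate_of_isTypeIBlowup' {ν T : ℝ} (hν : 0 < ν)
    {u : ℝ → EuclideanSpace ℝ (Fin 3) → EuclideanSpace ℝ (Fin 3)} (hI : IsTypeIBlowup u T) :
    ∃ C : ℝ, ∀ᶠ t in 𝓝[<] T, ∀ x, Real.sqrt (T - t) * ‖u t x‖ ≤ C * Real.sqrt ν := by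
  obtain ⟨C, hC⟩ := hI
  have hsν : 0 < Real.sqrt ν := Real.sqrt_pos.2 hν
  refine ⟨max C 0 / Real.sqrt ν, ?_⟩
  have hlt : ∀ᶠ t in 𝓝[<] T, t < T := eventually_nhdsWithin_of_forall fun t ht => ht
  filter_upwards [hC, hlt] with t ht htT x
  have hst : 0 < Real.sqrt (T - t) := Real.sqrt_pos.2 (sub_pos.2 htT)
  rw [div_mul_cancel₀ _ hsν.ne']
  have h1 : ‖u t x‖ ≤ max C 0 / Real.sqrt (T - t) :=
    (ht x).trans (div_le_div_of_nonneg_right (le_max_left _ _) hst.le)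
  rw [le_div_iff₀ hst] at h1
  calc Real.sqrt (T - t) * ‖u t x‖ = ‖u t x‖ * Real.sqrt (T - t) := mul_comm _ _
    _ ≤ max C 0 := h1

/-- **K1 ⟹ the window law on the Type-I class** (one time integration; conclusion verbatim that of
`EnergyHalfHolder`). [folklore] -/
theorem energyHalfHolderTypeI_of_quarterLawTypeI (h : QuarterLawTypeI) :
    ∀ (ν T : ℝ), 0 < ν → 0 < T →
      ∀ (u : ℝ → EuclideanSpace ℝ (Fin 3) → EuclideanSpace ℝ (Fin 3))
        (p : ℝ → EuclideanSpace ℝ (Fin 3) → ℝ),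
        IsMaximalSmoothSolution ν 0 u p T → IsLerayHopfOn T ν 0 (u 0) u →
        HasRapidSpatialDecay (u 0) → IsTypeIBlowup u T →
        ∃ K : ℝ, ∀ a b : ℝ, 0 ≤ a → a ≤ b → b ≤ T →
          ∫⁻ t in Ioo a b, ∫⁻ x, ‖curl (u t) x‖ₑ ^ 2 ≤ ENNReal.ofReal (K * Real.sqrt (b - a)) := by
  intro ν T hν hT u p hmax hLH hdec hI
  obtain ⟨K, hK⟩ := h ν T hν hT u p hmax hLH hdec hI
  have hK' : ∀ t ∈ Ico 0 T, ∫⁻ x, ‖curl (u t) x‖ₑ ^ 2 ≤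
      ENNReal.ofReal (max K 0 / Real.sqrt (T - t)) := fun t ht =>
    (hK t ht).trans (ENNReal.ofReal_le_ofReal
      (div_le_div_of_nonneg_right (le_max_left _ _) (Real.sqrt_nonneg _)))
  exact ⟨2 * max K 0, fun a b ha hab hb =>
    WindowConverters.lintegral_Ioo_le_sqrt_of_slice_le (le_max_right _ _) hK' ha hab hb⟩

/-- **The window law on the Type-I class ⟹ K1** (the converse: `quarterLaw_of_terminalWindowLaw_of_rate`
with `b = T`). [folklore] -/
theorem quarterLawTypeI_of_energyHalfHolderTypeI
    (h : ∀ (ν T : ℝ), 0 < ν → 0 < T →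
      ∀ (u : ℝ → EuclideanSpace ℝ (Fin 3) → EuclideanSpace ℝ (Fin 3))
        (p : ℝ → EuclideanSpace ℝ (Fin 3) → ℝ),
        IsMaximalSmoothSolution ν 0 u p T → IsLerayHopfOn T ν 0 (u 0) u →
        HasRapidSpatialDecay (u 0) → IsTypeIBlowup u T →
        ∃ K : ℝ, ∀ a b : ℝ, 0 ≤ a → a ≤ b → b ≤ T →
          ∫⁻ t in Ioo a b, ∫⁻ x, ‖curl (u t) x‖ₑ ^ 2 ≤ ENNReal.ofReal (K * Real.sqrt (b - a))) :
    QuarterLawTypeI := by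
  intro ν T hν hT u p hmax hLH hdec hI
  obtain ⟨C, hrate⟩ := exists_rate_of_isTypeIBlowup' hν hI
  obtain ⟨K, hK⟩ := h ν T hν hT u p hmax hLH hdec hI
  exact quarterLaw_of_terminalWindowLaw_of_rate hν hT hmax.1 hLH hdec hrate
    ⟨K, fun a ha => hK a T ha.1 ha.2.le le_rfl⟩

/-- **`QuarterLawTypeI` (23726) ⟺ `EnergyHalfHolder` (25161) restricted to the Type-I blow-ups of
K1's class**: along sup-norm Type-I blow-ups, Leray's upper quarter rate on the slices IS the
½-Hölder law of the energy (window quarter law). [folklore] -/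
theorem quarterLawTypeI_iff_energyHalfHolderTypeI :
    QuarterLawTypeI ↔
      ∀ (ν T : ℝ), 0 < ν → 0 < T →
        ∀ (u : ℝ → EuclideanSpace ℝ (Fin 3) → EuclideanSpace ℝ (Fin 3))
          (p : ℝ → EuclideanSpace ℝ (Fin 3) → ℝ),
          IsMaximalSmoothSolution ν 0 u p T → IsLerayHopfOn T ν 0 (u 0) u →
          HasRapidSpatialDecay (u 0) → IsTypeIBlowup u T →
          ∃ K : ℝ, ∀ a b : ℝ, 0 ≤ a → a ≤ b → b ≤ T →
            ∫⁻ t in Ioo a b, ∫⁻ x, ‖curl (u t) x‖ₑ ^ 2 ≤ ENNReal.ofReal (K * Real.sqrt (b - a)) :=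
  ⟨energyHalfHolderTypeI_of_quarterLawTypeI, quarterLawTypeI_of_energyHalfHolderTypeI⟩

/-- **Inter-route edge: `EnergyHalfHolder` (25161, route HalfHolderEnergy) ⟹ `QuarterLawTypeI`
(23726, route TypeIQuarterGate)**, unconditionally (a Type-I blow-up is in particular a blow-up).
[folklore] -/
theorem quarterLawTypeI_of_energyHalfHolder (h : EnergyHalfHolder) : QuarterLawTypeI :=
  quarterLawTypeI_of_energyHalfHolderTypeI fun ν T hν hT u p hmax hLH hdec _hI =>
    h ν T hν hT u p hmax hLH hdec

end QuarterLawWindow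

end Summit.NavierStokesRegularity.NavierStokesRegularity.Theorems

end
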